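import Mathlib
import HarnessLib.Audit
import Summits.PneNP.PneNP.Theorems.PstarCrossCorner

/-!
# The blind free CROSS gate: corner squares from an ARBITRARY switched-on variable set (non-private switching) (O2 / E1; prover-1 g22)

FRONTIER range-avoidance ladder, rung F-N3 (`stmt-PneNP-19007`), cell `pnp-ideate`; restricted-model proof complexity — nothing here bears on `P` versus `NP`.

`PstarCrossCorner.corner_square` switches on PRIVATE tree edges only.  The residual configurations of node N1 (levels `≠ (0,0)` with all private edges of a
Venn class pinned; levels `(0,0)` with no private edge in `D_p Δ D_q`) need switching sets through NON-private tree edges, which is sound as long as no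
tree edge outside the switched set gets both AND variables switched on (`PstarCrossCorner.u_ind` already takes exactly this as its hypothesis).  This file
states the square and pair lemmas for an arbitrary variable set `W`:

* `polar_zero_of_cornerW` — if the four indicator points `𝟙_{W ∪ R}`, `R ⊆ {v, w}` (`v, w ∉ W`, `v ≠ w`), all lie in the corner `{u_p = u_q = 0}`, then every
  quadratic `q` constant on the corner has `Bq(e_w, e_v) = 0`;
* `lin_of_cornerW` — if `𝟙_W` and `𝟙_{W ∪ {v}}` lie in the corner then `q(e_v) + q(0) = Bq(𝟙_W, e_v)`;
* `corner_of_count` — the corner membership of `𝟙_W` from the edge counts: if the tree edges of `D_p` (resp. `D_q`) with both AND variables in `W` are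
  exactly those of `S`, then `𝟙_W` is in the corner iff `γ_p + #(D_p ∩ S) = 0 = γ_q + #(D_q ∩ S)` (`PstarCrossCorner.u_ind`).
-/

set_option linter.dupNamespace false -- `Summit.PneNP.PneNP.…`: summit = sub-problem name (D-0017 single-conjunct layout)

open Finset Literature.Computability.Complexity
open Summit.PneNP.PneNP.Theorems.PstarChordSystem (ChordSystem)
open Summit.PneNP.PneNP.Theorems.PstarChordBridgeTools
open Summit.PneNP.PneNP.Theorems.PstarChordBridge
open Summit.PneNP.PneNP.Theorems.PstarChordBridgeForcing (gam)
open Summit.PneNP.PneNP.Theorems.PstarCrossCorner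

namespace Summit.PneNP.PneNP.Theorems.PstarCrossCornerGen

variable {n m : ℕ}

section

variable (I : LocalMap 4 n m) (B : BridgeData n m) (e_p e_q : Fin m)

/-- **Corner square from an arbitrary switched-on set.** -/
theorem polar_zero_of_cornerW {q : (Fin n → ZMod 2) → ZMod 2} {Bq : LinearMap.BilinForm (ZMod 2) (Fin n → ZMod 2)}
    (hq : ∀ x y, q (x + y) = q x + q y + q 0 + Bq x y) {κ : ZMod 2} (hK : ∀ a, (sys I B).u e_p a = 0 → (sys I B).u e_q a = 0 → q a = κ)
    {W : Finset (Fin n)} {v w : Fin n} (hv : v ∉ W) (hw : w ∉ W) (hvw : v ≠ w)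
    (h4 : ∀ R : Finset (Fin n), R ⊆ {v, w} → (sys I B).u e_p (ind (W ∪ R)) = 0 ∧ (sys I B).u e_q (ind (W ∪ R)) = 0) :
    Bq (Pi.single w 1) (Pi.single v 1) = 0 := by
  classical
  have hq_at : ∀ R : Finset (Fin n), R ⊆ {v, w} → q (ind (W ∪ R)) = κ := fun R hR => hK _ (h4 R hR).1 (h4 R hR).2
  have e00 := hq_at ∅ (empty_subset _)
  have e10 := hq_at {v} (by simp)
  have e01 := hq_at {w} (by simp)
  have e11 := hq_at {v, w} subset_rfl
  rw [union_empty] at e00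
  rw [show W ∪ {v} = insert v W by ext u; simp only [mem_union, mem_insert, mem_singleton]; tauto, ind_insert hv] at e10
  rw [show W ∪ {w} = insert w W by ext u; simp only [mem_union, mem_insert, mem_singleton]; tauto, ind_insert hw] at e01
  rw [show W ∪ {v, w} = insert w (insert v W) by ext u; simp only [mem_union, mem_insert, mem_singleton]; tauto,
    ind_insert (by rw [mem_insert]; push Not; exact ⟨hvw.symm, hw⟩), ind_insert hv] at e11
  have h := polar_zero_of_square hq e00 e10 e01 e11
  have hsymm : Bq (Pi.single w 1) (Pi.single v 1) = Bq (Pi.single v 1) (Pi.single w 1) := by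
    have h1 := hq (Pi.single v 1) (Pi.single w 1)
    have h2 := hq (Pi.single w 1) (Pi.single v 1)
    rw [show (Pi.single w (1 : ZMod 2) : Fin n → ZMod 2) + Pi.single v 1 = Pi.single v 1 + Pi.single w 1 from add_comm _ _] at h2
    have e3 : ∀ s a b c x y : ZMod 2, s = a + b + c + x → s = b + a + c + y → y = x := by decide
    exact e3 _ _ _ _ _ _ h1 h2
  rw [hsymm]; exact h

/-- **Corner pair from an arbitrary switched-on set**: `q(e_v) + q(0) = Bq(𝟙_W, e_v)`. -/
theorem lin_of_cornerW {q : (Fin n → ZMod 2) → ZMod 2} {Bq : LinearMap.BilinForm (ZMod 2) (Fin n → ZMod 2)}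
    (hq : ∀ x y, q (x + y) = q x + q y + q 0 + Bq x y) {κ : ZMod 2} (hK : ∀ a, (sys I B).u e_p a = 0 → (sys I B).u e_q a = 0 → q a = κ)
    {W : Finset (Fin n)} {v : Fin n} (hv : v ∉ W)
    (h0 : (sys I B).u e_p (ind W) = 0 ∧ (sys I B).u e_q (ind W) = 0)
    (h1 : (sys I B).u e_p (ind (insert v W)) = 0 ∧ (sys I B).u e_q (ind (insert v W)) = 0) :
    q (Pi.single v 1) + q 0 = Bq (ind W) (Pi.single v 1) := by
  have e0 := hK _ h0.1 h0.2
  have e1 := hK _ h1.1 h1.2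
  rw [ind_insert hv] at e1
  exact lin_eq_of_pair hq e0 e1

/-- **Corner membership of an indicator point from the edge counts** (both gate chords at once). -/
theorem corner_of_count {W : Finset (Fin n)} {S : Finset (Fin m)}
    (hWp : ∀ k ∈ B.D e_p, (I.vars k 2 ∈ W ∧ I.vars k 3 ∈ W) ↔ k ∈ S) (hWq : ∀ k ∈ B.D e_q, (I.vars k 2 ∈ W ∧ I.vars k 3 ∈ W) ↔ k ∈ S)
    (hSp : gam B e_p + (((B.D e_p).filter fun k => k ∈ S).card : ZMod 2) = 0)
    (hSq : gam B e_q + (((B.D e_q).filter fun k => k ∈ S).card : ZMod 2) = 0) :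
    (sys I B).u e_p (ind W) = 0 ∧ (sys I B).u e_q (ind W) = 0 := by
  rw [u_ind I B e_p hWp, u_ind I B e_q hWq]
  exact ⟨hSp, hSq⟩

end

end Summit.PneNP.PneNP.Theorems.PstarCrossCornerGen
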